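import Summits.BirchSwinnertonDyer.BirchSwinnertonDyer.Theorems.KolyvaginRoadThreeMethod2LocalFrobenius
import Summits.BirchSwinnertonDyer.BirchSwinnertonDyer.Theorems.AdditiveKolyvaginRoadLevelDefs
import Literature.NumberTheory.GaloisRepresentations.IntegralGaloisActionProofs
import HarnessLib

/-!
# Route `AdditiveKolyvaginRoad`, crux `KolyvaginPrimitiveAdditive` (item stmt-BirchSwinnertonDyer-20132):
# stub A1 `stub_rankLoweringAdditive` — the TORIC local condition on the decomposition group, and (Trans)
# (`H¹_f ∩ H¹_tor = 0`) at EVERY good place, in structural form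
# (cell `pub/bsd-wall`, lead prover `bsd-wall-akr-p1` g2; `--supports stmt-BirchSwinnertonDyer-20132`, helper;
# p-generic companion of zhang3-p1's `Theorems/KolyvaginRoadThreeMethod2LocalFrobenius.lean`, ordinary ↦ TORIC)

WHY THIS FILE. `Theorems/AdditiveKolyvaginRoadRankLoweringReduction.lean` (akr-p1 g0, p511644) reduced the registered
stub A1 of crux 20132 — (A1) rank lowering for the p-generic canonical level-raised Selmer spaces `SelQP` of
`AdditiveKolyvaginRoadLevelDefs` (local condition at the level primes = the TORIC condition `toricLocalKer`: values in
the augmentation subgroup `I_Γ · E[n]`) — to five local–global inputs at ONE Bertolini–Darmon admissible prime: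
(Cheb), (Equiv), (Line), (Trans), (Iso). Two of them — (Trans) here, (Line) in the sibling
`AdditiveKolyvaginRoadLocalFrobenius.lean` — are statements about `H¹(K_v, E[n])` alone. This file supplies:

* §1 subgroups of a group of order `p²` (`E[p] ≃ (ℤ/p)²`): a proper subgroup has order `≤ p`, a non-trivial one
  order `≥ p`; a non-zero additive endomorphism `g` has cyclic cokernel in the sense of zhang3-p1's (Line) binder
  (`y ∈ im g` or `y` generates modulo `im g`); if `g` has a non-zero kernel its image has order `≤ p`.
* §2 the TORIC local condition on the decomposition group: zhang3-p1's cocycle criteria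
  (`LocalFrob.oneCocycleClass_mem_torsionLocalKer_iff` ∕ `…_ordinaryLocalKer_iff`) completed by the criterion for
  `toricLocalKer` — `x ∈ toricLocalKer ⟺ φ_x|_{G_𝔓} ≡ ∂P` modulo the augmentation subgroup
  `⟨d x − x : d ∈ G_𝔓⟩` of `G_𝔓 = 𝔓_{ι₀,𝔐}` on `E(K̄)[n]` (the two augmentation subgroups correspond under
  `E(K̄)[n] ⥲ E(K̄_v)[n]`, `G_𝔓 = res Γ_{K_v}`, Neukirch II (9.6)); at a good place `v ∤ n` that subgroup is
  `(F − 1)E[n]` for ANY arithmetic Frobenius `F` at `𝔓` (`G_𝔓 = ⟨F⟩·I_𝔓·U`, Neukirch I (9.4), inertia trivial on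
  `E[n]`); hence (Trans) in structural form with NO hypothesis on the Frobenius: an unramified cocycle
  `≡ ∂P (mod (F − 1)E[n])` on `G_𝔓` has `φ(F) ∈ (F − 1)E[n]`, i.e. localisation zero (zhang3-p1's
  `oneCocycleClass_mem_torsionLocalKer_iff_apply_frob`, Gross Prop. 9.6 generalised) — Bertolini–Darmon Lemma 2.6,
  the half `H¹_fin ∩ H¹_ord = 0`.

HONEST FRAMING: theorems only; no definition, no named fact, no `sorry`; pure local–global Galois cohomology of an
elliptic curve over a number field; nothing about Heegner points or the crux is asserted; nothing is booked.

References: [cite: BertoliniDarmon2005, §2.2–§2.3, Lemma 2.6] [cite: WZhang2014, §4.1 (H¹_ord, H¹_fin), Prop. 5.4]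
[cite: GrossLMS1991, §9 Prop. 9.6] [cite: NeukirchANT1999, Ch. I §9 (9.4), Ch. II §9 (9.6)].
-/

-- single-conjunct summit: `Summit.BirchSwinnertonDyer.BirchSwinnertonDyer.…` repeats the name by design
set_option linter.dupNamespace false

noncomputable section

open scoped Classical Pointwise
open Polynomial

universe u

namespace Summit.BirchSwinnertonDyer.BirchSwinnertonDyer.Theorems.AdditiveKoly

open WeierstrassCurve NumberField IsDedekindDomain Field Rat.HeightOneSpectrum
open Literature.NumberTheory.EllipticCurves Literature.NumberTheory.GaloisRepresentations Module
open Summit.BirchSwinnertonDyer.Rank1Residual.X11b.Three.Koly.Method2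

/-! ## §1 Subgroups and endomorphisms of a group of order `p²` -/

section OrderSq

variable {T : Type*} [AddCommGroup T] {p : ℕ}

/-- A subgroup of a group of order `p²` (`p` prime) has order `p ^ k` with `k ≤ 2`. [folklore] -/
theorem exists_natCard_eq_pow (hp : p.Prime) (hcard : Nat.card T = p ^ 2) (H : AddSubgroup T) :
    ∃ k ≤ 2, Nat.card H = p ^ k := by
  haveI : Finite T := Nat.finite_of_card_ne_zero (by rw [hcard]; exact pow_ne_zero 2 hp.ne_zero)
  have hdvd : Nat.card H ∣ p ^ 2 := hcard ▸ H.card_addSubgroup_dvd_card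
  exact (Nat.dvd_prime_pow hp).mp hdvd

/-- **A proper subgroup of a group of order `p²` has order `≤ p`.** [folklore] -/
theorem natCard_le_of_ne_top (hp : p.Prime) (hcard : Nat.card T = p ^ 2) {H : AddSubgroup T} (hH : H ≠ ⊤) :
    Nat.card H ≤ p := by
  haveI : Finite T := Nat.finite_of_card_ne_zero (by rw [hcard]; exact pow_ne_zero 2 hp.ne_zero)
  obtain ⟨k, hk, hk'⟩ := exists_natCard_eq_pow hp hcard H
  have hk2 : k ≠ 2 := by
    rintro rfl
    exact hH (AddSubgroup.eq_top_of_card_eq H (by rw [hk', hcard]))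
  rw [hk']
  calc p ^ k ≤ p ^ 1 := Nat.pow_le_pow_right hp.pos (by omega)
    _ = p := pow_one p

/-- **A non-trivial subgroup of a group of order `p²` has order `≥ p`.** [folklore] -/
theorem le_natCard_of_ne_bot (hp : p.Prime) (hcard : Nat.card T = p ^ 2) {H : AddSubgroup T} (hH : H ≠ ⊥) :
    p ≤ Nat.card H := by
  haveI : Finite T := Nat.finite_of_card_ne_zero (by rw [hcard]; exact pow_ne_zero 2 hp.ne_zero)
  obtain ⟨k, hk, hk'⟩ := exists_natCard_eq_pow hp hcard H
  have hk0 : k ≠ 0 := by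
    rintro rfl
    rw [pow_zero] at hk'
    exact hH (AddSubgroup.eq_bot_of_card_eq H hk')
  rw [hk']
  calc p = p ^ 1 := (pow_one p).symm
    _ ≤ p ^ k := Nat.pow_le_pow_right hp.pos (by omega)

/-- **Cyclic cokernel of a non-zero endomorphism of a group of order `p²`** (zhang3-p1's binder shape for (Line)):
for `g ≠ 0`, every `y` lies in `im g` or generates the group together with `im g` — `z = a • y + g m`. (If
`y ∉ im g`, the subgroup `ℤy + im g` strictly contains `im g`, of order `≥ p`, so it is everything.) [folklore] -/
theorem mem_range_or_generates (hp : p.Prime) (hcard : Nat.card T = p ^ 2) (g : T →+ T) (hg : g ≠ 0) (y : T) :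
    (∃ m, y = g m) ∨ ∀ z, ∃ (a : ℤ) (m : T), z = a • y + g m := by
  haveI : Finite T := Nat.finite_of_card_ne_zero (by rw [hcard]; exact pow_ne_zero 2 hp.ne_zero)
  by_cases hy : y ∈ g.range
  · obtain ⟨m, hm⟩ := hy
    exact Or.inl ⟨m, hm.symm⟩
  right
  have hbot : g.range ≠ ⊥ := by
    intro h
    apply hg
    ext t
    have ht : g t ∈ g.range := ⟨t, rfl⟩
    rw [h, AddSubgroup.mem_bot] at ht
    rw [ht, AddMonoidHom.zero_apply]
  set H := AddSubgroup.zmultiples y ⊔ g.range with hHdef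
  have htop : H = ⊤ := by
    by_contra hne
    have hle : Nat.card H ≤ Nat.card g.range :=
      (natCard_le_of_ne_top hp hcard hne).trans (le_natCard_of_ne_bot hp hcard hbot)
    have heq : g.range = H := AddSubgroup.eq_of_le_of_card_ge le_sup_right hle
    apply hy
    rw [heq]
    exact AddSubgroup.mem_sup_left (AddSubgroup.mem_zmultiples y)
  intro z
  have hz : z ∈ H := by rw [htop]; exact AddSubgroup.mem_top z
  obtain ⟨u, hu, w, hw, huw⟩ := AddSubgroup.mem_sup.mp hz
  obtain ⟨a, rfl⟩ := AddSubgroup.mem_zmultiples_iff.mp hu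
  obtain ⟨m, rfl⟩ := hw
  exact ⟨a, m, huw.symm⟩

/-- **An endomorphism of a group of order `p²` with a non-zero kernel has image of order `≤ p`** (it is not
injective, hence not surjective). [folklore] -/
theorem natCard_range_le_of_exists_ker (hp : p.Prime) (hcard : Nat.card T = p ^ 2) (g : T →+ T)
    (hy : ∃ y, y ≠ 0 ∧ g y = 0) : Nat.card g.range ≤ p := by
  haveI : Finite T := Nat.finite_of_card_ne_zero (by rw [hcard]; exact pow_ne_zero 2 hp.ne_zero)
  refine natCard_le_of_ne_top hp hcard fun htop ↦ ?_
  obtain ⟨y, hy0, hgy⟩ := hy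
  have hsurj : Function.Surjective g := fun t ↦ by
    have ht : t ∈ g.range := by rw [htop]; exact AddSubgroup.mem_top t
    exact ht
  have hinj : Function.Injective g := Finite.injective_iff_surjective.mpr hsurj
  exact hy0 (hinj (by rw [hgy, map_zero]))

end OrderSq

/-! ## §2 The toric local condition on the decomposition group; (Trans) at every good place -/

namespace ToricFrob

variable {K : Type u} [Field K] [NumberField K] (W : WeierstrassCurve K) {v : HeightOneSpectrum (𝓞 K)}

section Criterion

variable [W.IsElliptic]

/-- **The toric condition on the decomposition group.** With `𝔓 = 𝔓_{ι₀,𝔐}` the prime of `\bar ℤ_K` cut out by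
the chosen embedding `ι₀ : K̄ → K̄_v` (`G_𝔓 = res Γ_{K_v}`, Neukirch II (9.6)): the class of a cocycle `φ` satisfies
the TORIC condition at `v` (`toricLocalKer`: localisation represented by a cocycle valued in the augmentation
subgroup `I_{Γ_{K_v}} · E(K̄_v)[n]`) iff for some `P ∈ E[n]` the map `d ↦ φ(d) − (dP − P)` on `G_𝔓` takes values in
the augmentation subgroup `⟨d'x − x : d' ∈ G_𝔓, x ∈ E[n]⟩` of `G_𝔓` on `E(K̄)[n]` (`⟹`: `φ∘res` minus such a local
cocycle is a local coboundary `∂Q`; `⟸`: `(φ − ∂P)∘res` is one; the two augmentation subgroups correspond under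
`E(K̄)[n] ⥲ E(K̄_v)[n]`). [cite: BertoliniDarmon2005, §2.2–§2.3 (H¹_ord)] [cite: WZhang2014, §4.1] -/
theorem oneCocycleClass_mem_toricLocalKer_iff {n : ℕ} (hn : n ≠ 0)
    {𝔐 : Ideal (HeightOneSpectrum.localAbsIntegers v)} (h𝔐 : 𝔐 ∈ v.localPrimesAbove)
    (φ : contOneCocycles (discreteTopRep (absoluteGaloisGroup K) (geomTorsion W (n : ℤ)))) :
    oneCocycleClass _ φ ∈ toricLocalKer W (v.adicCompletion K) n ↔
      ∃ P : geomTorsion W (n : ℤ),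
        ∀ d ∈ (v.primeBelow (closureEmb (K := K) (v.adicCompletion K)) 𝔐).decompositionSubgroup (absoluteGaloisGroup K),
          φ.1 d - (d • P - P) ∈ AddSubgroup.closure
            {m : geomTorsion W (n : ℤ) | ∃ d' ∈ (v.primeBelow (closureEmb (K := K) (v.adicCompletion K))
              𝔐).decompositionSubgroup (absoluteGaloisGroup K), ∃ x : geomTorsion W (n : ℤ), m = d' • x - x} := by
  haveI : CharZero (v.adicCompletion K) :=
    charZero_of_injective_algebraMap (algebraMap K (v.adicCompletion K)).injective
  set ι₀ := closureEmb (K := K) (v.adicCompletion K) with hι₀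
  set Kv := v.adicCompletion K with hKv
  set D := (v.primeBelow ι₀ 𝔐).decompositionSubgroup (absoluteGaloisGroup K) with hD
  set A : AddSubgroup (geomTorsion W (n : ℤ)) :=
    AddSubgroup.closure {m : geomTorsion W (n : ℤ) | ∃ d' ∈ D, ∃ x : geomTorsion W (n : ℤ), m = d' • x - x} with hA
  set tPM := torsionPointsMap W Kv n with htPM
  have hbij := torsionPointsMap_bijective W Kv hn
  have hlift : ∀ d ∈ D, ∃ σ : absoluteGaloisGroup Kv, resGal (K := K) Kv σ = d := fun d hd ↦ by
    obtain ⟨σ, hσ⟩ := exists_apply_eq_smul_of_mem_decompositionSubgroup ι₀ h𝔐 hd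
    exact ⟨σ, by rw [resGal_eq]; exact resGalOfEmb_eq_of_apply_eq ι₀ hσ⟩
  have hresmem : ∀ g : absoluteGaloisGroup Kv, resGal (K := K) Kv g ∈ D := fun g ↦ by
    rw [hD, resGal_eq]; exact resGalOfEmb_mem_decompositionSubgroup ι₀ h𝔐 g
  -- the two augmentation subgroups correspond under `tPM`
  have hmapA : A.map tPM =
      augmentationPoints (absoluteGaloisGroup Kv) (AddSubgroup.torsionBy (localPoints W Kv) (n : ℤ)) := by
    rw [hA, AddMonoidHom.map_closure]
    unfold augmentationPoints
    congr 1
    ext m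
    simp only [Set.mem_image, Set.mem_setOf_eq]
    constructor
    · rintro ⟨m', ⟨d', hd', x, rfl⟩, rfl⟩
      obtain ⟨σ, rfl⟩ := hlift d' hd'
      exact ⟨σ, tPM x, by rw [map_sub, htPM, torsionPointsMap_smul]⟩
    · rintro ⟨σ, y, rfl⟩
      obtain ⟨x, rfl⟩ := hbij.2 y
      exact ⟨resGal (K := K) Kv σ • x - x, ⟨_, hresmem σ, x, rfl⟩, by rw [map_sub, htPM, torsionPointsMap_smul]⟩
  have hmemA : ∀ m : geomTorsion W (n : ℤ),
      tPM m ∈ augmentationPoints (absoluteGaloisGroup Kv) (AddSubgroup.torsionBy (localPoints W Kv) (n : ℤ)) ↔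
        m ∈ A := fun m ↦ by
    rw [← hmapA]
    constructor
    · rintro ⟨m', hm', hmm'⟩
      rw [← hbij.1 hmm']
      exact hm'
    · exact fun hm ↦ AddSubgroup.mem_map_of_mem tPM hm
  have hmem : ∀ x : galH1Torsion W (n : ℤ), x ∈ toricLocalKer W Kv n ↔
      ∃ ψ : contOneCocycles (discreteTopRep (absoluteGaloisGroup Kv) (AddSubgroup.torsionBy (localPoints W Kv) (n : ℤ))),
        (∀ g, ψ.1 g ∈ augmentationPoints (absoluteGaloisGroup Kv) (AddSubgroup.torsionBy (localPoints W Kv) (n : ℤ)))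
        ∧ oneCocycleClass _ ψ = W.torsionLocMap Kv n x := fun x ↦ by
    change x ∈ AddSubgroup.comap _ _ ↔ _
    rw [AddSubgroup.mem_comap]; rfl
  rw [hmem, LocalFrob.torsionLocMap_oneCocycleClass]
  constructor
  · rintro ⟨ψ, hψL, hψ⟩
    -- `φ∘res − ψ` is a local coboundary `∂Q`
    have h0 : oneCocycleClass _ (contOneCocycles.pullback (resGal (K := K) Kv)
        (resHomOfEquivariant (resGal (K := K) Kv) (torsionPointsMap W Kv n) (torsionPointsMap_smul W Kv n)) φ - ψ) =
        0 := by rw [oneCocycleClass_sub, hψ, sub_self]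
    obtain ⟨Q, hQ⟩ := (oneCocycleClass_eq_zero_iff _ _).mp h0
    obtain ⟨P, rfl⟩ := hbij.2 Q
    refine ⟨P, fun d hd ↦ ?_⟩
    obtain ⟨σ, rfl⟩ := hlift d hd
    -- the value `φ(res σ) − (res σ • P − P)` maps to `ψ σ ∈ L`
    have hval : tPM (φ.1 (resGal (K := K) Kv σ) - (resGal (K := K) Kv σ • P - P)) = ψ.1 σ := by
      have h := hQ σ
      rw [discreteTopRep_ρ_apply] at h
      change torsionPointsMap W Kv n (φ.1 (resGal (K := K) Kv σ)) - ψ.1 σ =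
        σ • torsionPointsMap W Kv n P - torsionPointsMap W Kv n P at h
      rw [map_sub, map_sub, htPM, torsionPointsMap_smul, sub_eq_iff_eq_add.mp h]; abel
    rw [← hmemA, hval]
    exact hψL σ
  · rintro ⟨P, hP⟩
    obtain ⟨φ', hφ', hφ'apply⟩ := LocalFrob.exists_cocycle_sub_coboundary W φ P
    refine ⟨contOneCocycles.pullback (resGal (K := K) Kv)
        (resHomOfEquivariant (resGal (K := K) Kv) (torsionPointsMap W Kv n) (torsionPointsMap_smul W Kv n)) φ',
      fun g ↦ ?_, by rw [← LocalFrob.torsionLocMap_oneCocycleClass, ← LocalFrob.torsionLocMap_oneCocycleClass, hφ']⟩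
    rw [contOneCocycles.pullback_apply]
    change torsionPointsMap W Kv n (φ'.1 (resGal (K := K) Kv g)) ∈ _
    rw [← htPM, hmemA, hφ'apply]
    exact hP _ (hresmem g)

end Criterion

section Augmentation

variable [W.IsElliptic]

/-- **The augmentation subgroup of the decomposition group is `(F − 1)E[n]`** when the inertia group acts trivially
on `E[n]` (good `v ∤ n`): every `d ∈ G_𝔓` is `Fᵏ · i · u` (`i ∈ I_𝔓`, `u ∈ Γ_{K(E[n])}`; Neukirch I (9.4), tree
`exists_eq_frobenius_pow_mul_of_mem_decompositionSubgroup`), so `dx − x = Fᵏx − x = (F − 1)(x + Fx + ⋯ + Fᵏ⁻¹x)`.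
[cite: NeukirchANT1999, Ch. I §9 Prop. (9.4)] -/
theorem closure_decomposition_eq_range {𝔓 : Ideal (absIntegers (𝓞 K) K)} (h𝔓 : 𝔓 ∈ v.primesAbove)
    {n : ℤ} (hn : n ≠ 0) {F : absoluteGaloisGroup K} (hF : IsArithFrobAt (𝓞 K) F 𝔓)
    (hI : 𝔓.inertia (absoluteGaloisGroup K) ≤ torsionFixing W n) :
    AddSubgroup.closure {m : geomTorsion W n | ∃ d' ∈ 𝔓.decompositionSubgroup (absoluteGaloisGroup K),
        ∃ x : geomTorsion W n, m = d' • x - x} =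
      (DistribSMul.toAddMonoidHom (geomTorsion W n) F - AddMonoidHom.id _).range := by
  haveI := h𝔓.1
  set g := DistribSMul.toAddMonoidHom (geomTorsion W n) F - AddMonoidHom.id _ with hg
  have hgapply : ∀ x, g x = F • x - x := fun x ↦ rfl
  apply le_antisymm
  · rw [AddSubgroup.closure_le]
    rintro m ⟨d, hd, x, rfl⟩
    obtain ⟨k, i, u, hi, hu, rfl⟩ :=
      exists_eq_frobenius_pow_mul_of_mem_decompositionSubgroup h𝔓 hF (isOpen_torsionFixing W hn) hd
    have hpow : ∀ k : ℕ, F ^ k • x - x ∈ g.range := by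
      intro k
      induction k with
      | zero => rw [pow_zero, one_smul, sub_self]; exact zero_mem _
      | succ k ih =>
        have heq : F ^ (k + 1) • x - x = g (F ^ k • x) + (F ^ k • x - x) := by
          rw [hgapply, pow_succ', mul_smul]; abel
        rw [heq]
        exact add_mem ⟨_, rfl⟩ ih
    change (F ^ k * i * u) • x - x ∈ g.range
    rw [mul_smul, mul_smul, smul_eq_of_mem_torsionFixing W n hu, smul_eq_of_mem_torsionFixing W n (hI hi)]
    exact hpow k
  · rintro m ⟨x, rfl⟩
    exact AddSubgroup.subset_closure ⟨F, hF.mem_stabilizer, x, hgapply x⟩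

/-- **(Trans) for the TORIC condition, in structural form, at EVERY good place.** Let `v` be a place of good
reduction, `v ∤ n` (`n ≠ 0`), `𝔓 = 𝔓_{ι₀,𝔐}`. A class satisfying BOTH the Kummer condition (`selmerLocalKer` =
unramified at a good `v ∤ n`, Gross (7.1)) and the toric condition at `v` has localisation ZERO:
`H¹_f(K_v, E[n]) ∩ H¹_tor = 0` (Bertolini–Darmon Lemma 2.6, the half that needs no hypothesis on `Frob_v`). Proof:
for an arithmetic Frobenius `F` at `𝔓` (it exists), `φ|_{I_𝔓} = 0` and `φ(F) − (FP − P) ∈ (F − 1)E[n]` (§2), so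
`φ(F) = F(P + m) − (P + m)` and zhang3-p1's criterion `oneCocycleClass_mem_torsionLocalKer_iff_apply_frob` applies.
[cite: BertoliniDarmon2005, §2.2 Lemma 2.6] [cite: GrossLMS1991, §7 (7.1), Prop. 9.6] -/
theorem selmerLocalKer_inf_toricLocalKer_le_torsionLocalKer (hgood : W.HasGoodReductionAt v) {n : ℕ} (hn : n ≠ 0)
    (hnv : ((n : ℤ) : 𝓞 K) ∉ v.asIdeal)
    {𝔐 : Ideal (HeightOneSpectrum.localAbsIntegers v)} (h𝔐 : 𝔐 ∈ v.localPrimesAbove) :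
    selmerLocalKer W (v.adicCompletion K) n ⊓ toricLocalKer W (v.adicCompletion K) n ≤
      W.torsionLocalKer (v.adicCompletion K) n := by
  intro x hx
  obtain ⟨hsel, htor⟩ := AddSubgroup.mem_inf.mp hx
  set ι₀ := closureEmb (K := K) (v.adicCompletion K) with hι₀
  have h𝔓 := HeightOneSpectrum.primeBelow_mem_primesAbove (ι := ι₀) h𝔐
  haveI := h𝔓.1
  obtain ⟨F, hF⟩ := HeightOneSpectrum.exists_isArithFrobAt_of_mem_primesAbove_holds h𝔓
  have hI : (v.primeBelow ι₀ 𝔐).inertia (absoluteGaloisGroup K) ≤ torsionFixing W n :=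
    inertia_le_torsionFixing W (fun h ↦ h hgood) hnv ι₀ h𝔐
  have hn' : (n : ℤ) ≠ 0 := by exact_mod_cast hn
  obtain ⟨φ, rfl⟩ := oneCocycleClass_surjective (discreteTopRep (absoluteGaloisGroup K) (geomTorsion W (n : ℤ))) x
  have hφI : ∀ τ ∈ (v.primeBelow ι₀ 𝔐).inertia (absoluteGaloisGroup K), φ.1 τ = 0 :=
    (W.oneCocycleClass_mem_selmerLocalKer_iff hgood hnv h𝔓 φ).mp hsel
  obtain ⟨P, hP⟩ := (oneCocycleClass_mem_toricLocalKer_iff W hn h𝔐 φ).mp htor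
  have hFD : F ∈ (v.primeBelow ι₀ 𝔐).decompositionSubgroup (absoluteGaloisGroup K) := hF.mem_stabilizer
  have hmem := hP F hFD
  rw [closure_decomposition_eq_range W h𝔓 hn' hF hI] at hmem
  obtain ⟨m, hm⟩ := hmem
  refine (LocalFrob.oneCocycleClass_mem_torsionLocalKer_iff_apply_frob W hn h𝔐 hF hI φ hφI).mpr ⟨P + m, ?_⟩
  have hm' : F • m - m = φ.1 F - (F • P - P) := hm
  rw [smul_add]
  have := sub_eq_iff_eq_add.mp hm'.symm
  rw [this]; abel

end Augmentation

end ToricFrob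

end Summit.BirchSwinnertonDyer.BirchSwinnertonDyer.Theorems.AdditiveKoly

end
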